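import Summits.QuantumFields.YangMills.Theorems.UnitScaleTiltProp7PoissonGradientDecay
import Summits.QuantumFields.YangMills.Theorems.UnitScaleTiltProp7KernelRow349OfCover
import Summits.QuantumFields.YangMills.Theorems.UnitScaleTiltHalvingSmallMembersCoverLift
import HarnessLib

/-!
# Route `UnitScaleTilt`, crux K1 «MinimiserStabilityRegPr» (stmt-QuantumFields-19200), EX face, norm_G ∕ h133 road — N6 FILE D letter (c2b) WITHOUT THE NO-WRAP ROOM:
# **THE DECAYED GRADIENT ROW OF A COVARIANT POISSON-TYPE EQUATION AT EVERY MEMBER** — px21 ✓`Prop7PoissonGradientDecay.gradient_decay_of_decay` with its no-wrap antecedent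
# `hroom : 2(12·L^{K−n} + 5) ≤ sitesPerDir 0` DELETED and the SAME constant, by READING THE PROOF ON THE `L³`-FOLD COVER `F.cover 3` (which has room, ✓`room_cover`):
# the equation `Δ^η_{U₀}u + q = 0` and the two fields lift (✓`covLapSite_cover`), `RegPr` lifts (✓`regPr_cover_iff`), the per-bond letter ✓`perBond_gradient_le_of_ball` is applied ON
# THE COVER with its ball-local sups bounded through the member's decay (the covering map shrinks the fine sup-distance, §1, and the coarse `ℓ¹` block distance, ✓`tdist_proj_le`),
# the weighted-sup absorption ✓`weighted_sup_absorption` runs over the COVER's bonds with the member-induced weight `e^{−κ·d(B π b̃₋, y)}`, and the gradient is read back downstairs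
# (✓`DL2_cover'`, ✓`projBond_surjective`).  No Voronoi split, no fibre sum: the constant is UNCHANGED (print: the constants of Thm 3.1 «do not depend on {Ω_j}», p.399 L1–3).
# (★★OWNER g35 13:08:10Z «(c2b) without room = first pen of px5 g15»; px5 g14 LOCATE evidence #50; width seat `ym3-torus-px5` gen 15.)

Cell `ym3-torus` (HUMAN RULING D-0037; rung R3 = SU(2) YM₃ on T³ — NOT d = 4, NOT infinite volume, NOT a mass gap, NOT Clay).  THEOREMS ONLY (0 `def`, 0 `sorry`, default heartbeats);
`--supports stmt-QuantumFields-19200 --as helper`; count-neutral.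

WHAT IS PROVED (ns `Summit.QuantumFields.YangMills.Theorems.Prop7PoissonGradientDecayAllMembers`; member `F`, ANY `n K`, `ℓ = L^{K−n}`).
* §1 ★ `tdist_siteEquiv_proj_le` — `π` shrinks the fine sup-distance of the [B9] chart: `tdist (e(π x̃)) (e(π z̃)) ≤ tdist (ẽ x̃) (ẽ z̃)`; ★ `tdist_iterBlockOf_proj_le` — and the coarse `ℓ¹`
  block distance: `d(B(π x̃), B(π z̃)) ≤ d(B̃ x̃, B̃ z̃)` (✓`proj_iterBlockOf` ∘ ✓`tdist_proj_le`); `room_cover_three` — the `L³`-fold cover has the no-wrap room for EVERY `n K`.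
* §2 ★★★ **`gradient_decay_of_decay_allMembers`** — ✓`gradient_decay_of_decay` VERBATIM WITHOUT `hroom`: for `u q` with `Δ^η_{U₀}u + q = D*_{U₀}0`, a block `y`, `κ ≥ 0`, decayed sup
  letters `‖u(e x)‖ ≤ A_u·e^{−κ·d(B x, y)}`, `‖q(e x)‖ ≤ A_q·e^{−κ·d(B x, y)}`, under `RegPr`, `0 < ε₀ ≤ 1` and the margin `C_g·(48ε₀(6√2√10 + 6√2))·e^{51κ} ≤ ½`:
  `‖(D_{U₀}u)(e b)‖ ≤ 2·(C_g·(A_u e^{51κ}·(2 + 2√2·4ε₀(3 + 2457C) + (24√10 + 48)(48ε₀)²) + A_q e^{51κ}) + 2√2·48ε₀·A_u e^{51κ})·e^{−κ·d(B b₋, y)}` at EVERY route bond `b`;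
  ★★ `gradient_decay_of_decay_allMembers'` — the same read through ✓`toL2` (`‖toL2⁻¹(D_{U₀}u) b‖`).
HYP-SAT (★★OWNER RULING №42).  Exactly ✓p770220's minus `hroom`: `RegPr` (the EX face's standing hypothesis), `0 < ε₀ ≤ 1`, the equation, two decayed sup letters (real-inequality schemas,
inhabited by (W1) ✓`hGsupW_of_regPr` ∕ ✓`hpenW_of_regPr` in (W4) §3's use), `hsmall` (smallness of `ε₀` against the universal `C_g`, K-free; folded into the cap `αC L` by (W8)).
Conclusions non-vacuous; no `Prop` placeholder; nothing conclusion-shaped is assumed.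
HONEST SCOPE.  A re-reading of px21's row on the cover; nothing of (c2b)'s editions (next file), FILE D, `norm_G`, `h133`, the EX rows, EX, 19200 or the rung is proved here;
the Yang–Mills mass gap is NOT proved.

References: T. Bałaban, CMP **99** (1985) 389–434 [Balaban1985BackgroundPropagators] (Thm 3.1 (3.42)–(3.47) pp.397–399, p.399 L1–3); CMP **96** (1984) 223–250
[Balaban1984PropagatorsII] (Lemma 2.1 (2.61)–(2.63) p.234, (2.15)–(2.19) pp.225–226); CMP **95** (1984) 17–40 [Balaban1984PropagatorsI] ((1.110) p.35); CMP **109** (1987)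
249–301 [Balaban1987RG1] ((0.1)–(0.3) pp.251–252).
-/

set_option autoImplicit false

noncomputable section

open scoped BigOperators Matrix.Norms.L2Operator InnerProductSpace ComplexConjugate

namespace Summit.QuantumFields.YangMills.Theorems.Prop7PoissonGradientDecayAllMembers

open Literature.MathematicalPhysics.QuantumFieldTheory.Balaban1983to89
open Literature.MathematicalPhysics.QuantumFieldTheory.Balaban1983to89.T3ContinuumYM3Torus
open B10Eq27TorusAxialLog (rel rel_apply)
open B4Sect5Torus (TSite tdist)
open B9SectCLatticeCarrier (Bond)
open B9Eq311L2Pairing (WL2)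
open B11Eq103H1Complex (SiteL2K BondL2K)
open B5Eq118OneStroke (iterBlockOf)
open T3PrintedRegularMinimiser (RegPr)
open Summit.QuantumFields.YangMills.Theorems.Prop7SectET3Transport (periodsT3 siteEquiv bondEquiv)
open Summit.QuantumFields.YangMills.Theorems.Prop7SectET3HilbertLetters (W₂ frobEquiv toL2 toL2S DL2 DstarL2 covLapSite toL2_symm_apply toL2_apply toL2S_apply)
open Summit.QuantumFields.YangMills.Theorems.Prop7RieszTauFrobNorm (norm_frobEquiv_le)
open Summit.QuantumFields.YangMills.Theorems.Prop7CurvedMemberLocalGradient (exists_curved_localGradient)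
open Summit.QuantumFields.YangMills.Theorems.Prop7WeightedGradientAbsorption (weighted_sup_absorption)
open Summit.QuantumFields.YangMills.Theorems.AxialGaugeChartGlue (norm_bgOfCfg_axialT_sub_le tdist_siteEquiv)
open Summit.QuantumFields.YangMills.Theorems.Prop7CurvedMemberBallLetters (decay_on_ball)
open Summit.QuantumFields.YangMills.Theorems.Prop7PoissonGradientDecay (perBond_gradient_le_of_ball)
open Summit.QuantumFields.YangMills.Theorems.CoverSites
open Summit.QuantumFields.YangMills.Theorems.CoverKernelFibreSum (tdist_proj_le)
open Summit.QuantumFields.YangMills.Theorems.Prop7CoverHilbertPullback (covLapSite_cover DL2_cover')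
open Summit.QuantumFields.YangMills.Theorems.Prop7KernelRow349OfCover (room_cover)
open Summit.QuantumFields.YangMills.Theorems.SmallMembersCoverLift (regPr_cover_iff)

variable (F : T3Family) (jc n K : ℕ)

/-! ## §1 The covering map shrinks both distances; the `L³`-fold cover has room -/

/-- ★ **`π` SHRINKS THE FINE SUP-DISTANCE OF THE [B9] CHART**: `tdist (e(π x̃)) (e(π z̃)) ≤ tdist (ẽ x̃) (ẽ z̃)` — coordinatewise, reduction modulo a divisor can only shrink the
least absolute residue (✓`natAbs_valMinAbs_castHom_le`; the sup twin of ✓`CoverSites.distSite_proj_le` in the route's `tdist ∘ siteEquiv` currency, ✓`tdist_siteEquiv`).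
[cite: Balaban1984PropagatorsI, (1.110) p.35] -/
theorem tdist_siteEquiv_proj_le (xt zt : Site ((F.cover jc).P K) 0) :
    tdist (periodsT3 F K) (siteEquiv F K (proj (F.P K) jc 0 xt)) (siteEquiv F K (proj (F.P K) jc 0 zt))
      ≤ tdist (periodsT3 (F.cover jc) K) (siteEquiv (F.cover jc) K xt) (siteEquiv (F.cover jc) K zt) := by
  rw [tdist_siteEquiv, tdist_siteEquiv]
  exact_mod_cast Finset.sup_mono_fun fun κ _ => by
    rw [rel_apply, rel_apply, proj_apply, proj_apply, ← map_sub]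
    exact natAbs_valMinAbs_castHom_le (sitesPerDir_dvd (F.P K) jc 0) _

omit jc in
/-- ★ **`π` SHRINKS THE COARSE `ℓ¹` BLOCK DISTANCE**: `d(B^{i}(π x̃), B^{i}(π z̃)) ≤ d(B̃^{i} x̃, B̃^{i} z̃)` for `i ≤ m + K` (✓`proj_iterBlockOf`, ✓`tdist_proj_le`).
[cite: Balaban1987RG1, (0.3) p.252; Balaban1984PropagatorsI, (1.110) p.35] -/
theorem tdist_iterBlockOf_proj_le (jc i : ℕ) (hi : i ≤ (F.P K).m + (F.P K).K) (xt zt : Site ((F.cover jc).P K) 0) :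
    Site.tdist (P := F.P K) (iterBlockOf i (proj (F.P K) jc 0 xt)) (iterBlockOf i (proj (F.P K) jc 0 zt))
      ≤ Site.tdist (P := (F.cover jc).P K) (iterBlockOf i xt) (iterBlockOf i zt) := by
  rw [← proj_iterBlockOf (F.P K) jc i hi xt, ← proj_iterBlockOf (F.P K) jc i hi zt]
  exact tdist_proj_le (F.P K) jc _ _

omit jc in
/-- **THE `L³`-FOLD COVER HAS THE NO-WRAP ROOM FOR EVERY `n K`**: `2(12·L^{K−n} + 5) ≤ sitesPerDir 0 = 2·L^{m+3+K}` (✓`room_cover` for `n ≤ K`; for `K < n` the left side is `34`).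
[cite: Balaban1987RG1, (0.1)–(0.2) pp.251–252] -/
theorem room_cover_three : 2 * (12 * (F.cover 3).L ^ (K - n) + 5) ≤ ((F.cover 3).P K).sitesPerDir 0 := by
  by_cases hnK : n ≤ K
  · exact room_cover F 3 hnK le_rfl
  · have hL3 : 3 ≤ F.L := by
      obtain ⟨⟨k, hk⟩, h1⟩ := F.hL
      omega
    have hm := F.hm
    have h0 : K - n = 0 := by omega
    show 2 * (12 * F.L ^ (K - n) + 5) ≤ 2 * F.L ^ (F.m + 3 + K - 0)
    rw [h0, pow_zero, Nat.sub_zero]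
    have h81 : 81 ≤ F.L ^ (F.m + 3 + K) :=
      calc 81 = 3 ^ 4 := by norm_num
        _ ≤ F.L ^ 4 := Nat.pow_le_pow_left hL3 4
        _ ≤ F.L ^ (F.m + 3 + K) := Nat.pow_le_pow_right (by omega) (by omega)
    omega

/-! ## §2 ★★★ The decayed gradient row at every member -/

variable {ε₀ : ℝ} (hε₀ : 0 < ε₀) (hε1 : ε₀ ≤ 1)
  (U₀ : GaugeField (F.P K) 0 (Matrix.specialUnitaryGroup (Fin 2) ℂ)) (hreg : RegPr F n K ε₀ U₀)
  (c₀ : ℝ) [Fact (0 < c₀)]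

omit jc in
include hε₀ hε1 hreg in
/-- ★★★ **THE DECAYED GRADIENT ROW OF A COVARIANT POISSON-TYPE EQUATION — AT EVERY MEMBER, NO ROOM** ([Balaban1985BackgroundPropagators] Thm 3.1 (3.42)–(3.44), weighted-sup
edition at a regular curved background; px21 ✓`gradient_decay_of_decay` with `hroom` deleted, SAME constant).  For `u q` with `Δ^η_{U₀}u + q = D*_{U₀}0`, a block `y`, a rate `κ ≥ 0`
and decayed sup letters `‖u(e x)‖ ≤ A_u·e^{−κ·d(B x, y)}`, `‖q(e x)‖ ≤ A_q·e^{−κ·d(B x, y)}` (coarse `ℓ¹` block distance) and the margin `C_g·(48ε₀(6√2√10 + 6√2))·e^{51κ} ≤ ½`: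
`‖(D_{U₀}u)(e b)‖ ≤ 2·(C_g·(A_u e^{51κ}·(2 + 2√2·4ε₀(3 + 2457C) + (24√10 + 48)(48ε₀)²) + A_q e^{51κ}) + 2√2·48ε₀·A_u e^{51κ})·e^{−κ·d(B b₋, y)}` at EVERY route bond `b`.
PROOF: on the `L³`-fold cover (room by `room_cover_three`, `RegPr` by ✓`regPr_cover_iff`, the equation by ✓`covLapSite_cover`) the per-bond letter ✓`perBond_gradient_le_of_ball` is the
`hloc` of ✓`weighted_sup_absorption` over the cover's bonds with the member-induced weight `M·e^{−κ·d(B(π b̃₋), y)}` (`near b̃ b̃′ := d(B̃ b̃₋, B̃ b̃′₋) ≤ 51`, neighbours are `51`-close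
downstairs by `tdist_iterBlockOf_proj_le`; the ball-local sups through ✓`decay_on_ball` downstairs and `tdist_siteEquiv_proj_le`); read back by ✓`DL2_cover'` at a lift of `b`.
[cite: Balaban1985BackgroundPropagators, Thm 3.1 (3.42)–(3.44) pp.397–398, p.399 L1–3; Balaban1984PropagatorsII, Lemma 2.1 (2.61)–(2.63) p.234, (2.15) p.225] -/
theorem gradient_decay_of_decay_allMembers (u q : SiteL2K ℂ 3 (periodsT3 F K) c₀ W₂)
    (h : covLapSite F n K c₀ U₀ u + q = DstarL2 F n K c₀ U₀ 0) (y : Site (F.P K) (K - n)) {κ Au Aq : ℝ} (hκ : 0 ≤ κ) (hAu : 0 ≤ Au) (hAq : 0 ≤ Aq)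
    (hu : ∀ x : Site (F.P K) 0, ‖WL2.equiv ℂ (fun _ : TSite 3 (periodsT3 F K) => c₀) W₂ u (siteEquiv F K x)‖
      ≤ Au * Real.exp (-(κ * (Site.tdist (P := F.P K) (iterBlockOf (K - n) x) y : ℝ))))
    (hq : ∀ x : Site (F.P K) 0, ‖WL2.equiv ℂ (fun _ : TSite 3 (periodsT3 F K) => c₀) W₂ q (siteEquiv F K x)‖
      ≤ Aq * Real.exp (-(κ * (Site.tdist (P := F.P K) (iterBlockOf (K - n) x) y : ℝ))))
    (hsmall : exists_curved_localGradient.choose * ((48 * ε₀) * (6 * Real.sqrt 2 * Real.sqrt 10 + 6 * Real.sqrt 2)) * Real.exp (51 * κ) ≤ 1 / 2) :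
    ∀ b : PBond (F.P K) 0, ‖WL2.equiv ℂ (fun _ : Bond 3 (periodsT3 F K) => c₀) W₂ (DL2 F n K c₀ U₀ u) (bondEquiv F K b)‖
      ≤ 2 * ((exists_curved_localGradient.choose *
            ((Au * Real.exp (51 * κ)) * (2 + 2 * Real.sqrt 2 * (4 * ε₀ * (3 + 2457 * norm_bgOfCfg_axialT_sub_le.choose)) + (24 * Real.sqrt 10 + 48) * (48 * ε₀) ^ 2)
              + Aq * Real.exp (51 * κ))
          + 2 * Real.sqrt 2 * (48 * ε₀) * (Au * Real.exp (51 * κ))))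
        * Real.exp (-(κ * (Site.tdist (P := F.P K) (iterBlockOf (K - n) b.src) y : ℝ))) := by
  classical
  -- the constant
  set M : ℝ := (exists_curved_localGradient.choose *
            ((Au * Real.exp (51 * κ)) * (2 + 2 * Real.sqrt 2 * (4 * ε₀ * (3 + 2457 * norm_bgOfCfg_axialT_sub_le.choose)) + (24 * Real.sqrt 10 + 48) * (48 * ε₀) ^ 2)
              + Aq * Real.exp (51 * κ))
          + 2 * Real.sqrt 2 * (48 * ε₀) * (Au * Real.exp (51 * κ))) with hM
  -- THE COVER `F.cover 3`: background, regularity, room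
  set Ut : GaugeField ((F.cover 3).P K) 0 (Matrix.specialUnitaryGroup (Fin 2) ℂ) := U₀ ∘ projBond (F.P K) 3 0 with hUt
  have hregt : RegPr (F.cover 3) n K ε₀ Ut := (regPr_cover_iff 3 F ε₀ U₀).mpr hreg
  have hroomt : 2 * (12 * (F.cover 3).L ^ (K - n) + 5) ≤ ((F.cover 3).P K).sitesPerDir 0 := room_cover_three F n K
  have hlev : K - n ≤ (F.P K).m + (F.P K).K := by show K - n ≤ F.m + K; omega
  -- the lifted fields and the lifted equation
  set l : Site (F.P K) 0 → Matrix (Fin 2) (Fin 2) ℂ := (toL2S F K c₀).symm u with hl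
  set lq : Site (F.P K) 0 → Matrix (Fin 2) (Fin 2) ℂ := (toL2S F K c₀).symm q with hlq
  have hul : toL2S F K c₀ l = u := (toL2S F K c₀).apply_symm_apply u
  have hqlq : toL2S F K c₀ lq = q := (toL2S F K c₀).apply_symm_apply q
  set ut : SiteL2K ℂ 3 (periodsT3 (F.cover 3) K) c₀ W₂ := toL2S (F.cover 3) K c₀ (l ∘ proj (F.P K) 3 0) with hut
  set qt : SiteL2K ℂ 3 (periodsT3 (F.cover 3) K) c₀ W₂ := toL2S (F.cover 3) K c₀ (lq ∘ proj (F.P K) 3 0) with hqt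
  have hsum : (toL2S F K c₀).symm (covLapSite F n K c₀ U₀ u) + lq = 0 := by
    rw [hlq, ← map_add, h, map_zero, map_zero]
  have hteq : covLapSite (F.cover 3) n K c₀ Ut ut + qt = DstarL2 (F.cover 3) n K c₀ Ut 0 := by
    have hΔ := covLapSite_cover F 3 n K c₀ U₀ l
    rw [hul] at hΔ
    rw [map_zero, hUt, hut, hΔ, hqt, ← map_add]
    have h0 : ∀ xt : Site ((F.cover 3).P K) 0, ((toL2S F K c₀).symm (covLapSite F n K c₀ U₀ u)) (proj (F.P K) 3 0 xt) + lq (proj (F.P K) 3 0 xt) = 0 :=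
      fun xt => by simpa only [Pi.add_apply, Pi.zero_apply] using congr_fun hsum (proj (F.P K) 3 0 xt)
    convert (toL2S (F.cover 3) K c₀).map_zero using 2
    funext xt
    simp only [Pi.add_apply, Function.comp_apply, Pi.zero_apply]
    exact h0 xt
  -- values of the lifts
  have hut_apply : ∀ z : TSite 3 (periodsT3 (F.cover 3) K),
      WL2.equiv ℂ (fun _ : TSite 3 (periodsT3 (F.cover 3) K) => c₀) W₂ ut z
        = WL2.equiv ℂ (fun _ : TSite 3 (periodsT3 F K) => c₀) W₂ u (siteEquiv F K (proj (F.P K) 3 0 ((siteEquiv (F.cover 3) K).symm z))) := by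
    intro z
    rw [hut, toL2S_apply, Function.comp_apply, ← hul, toL2S_apply, Equiv.symm_apply_apply]
  have hqt_apply : ∀ z : TSite 3 (periodsT3 (F.cover 3) K),
      WL2.equiv ℂ (fun _ : TSite 3 (periodsT3 (F.cover 3) K) => c₀) W₂ qt z
        = WL2.equiv ℂ (fun _ : TSite 3 (periodsT3 F K) => c₀) W₂ q (siteEquiv F K (proj (F.P K) 3 0 ((siteEquiv (F.cover 3) K).symm z))) := by
    intro z
    rw [hqt, toL2S_apply, Function.comp_apply, ← hqlq, toL2S_apply, Equiv.symm_apply_apply]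
  -- the fine ball downstairs: `tdist (ẽ c̃) z̃ ≤ 12ℓ + 4 ⇒ tdist (e(π c̃)) (e(π ẽ⁻¹ z̃)) ≤ 12ℓ + 4`
  have hball : ∀ (ct : Site ((F.cover 3).P K) 0) (z : TSite 3 (periodsT3 (F.cover 3) K)),
      tdist (periodsT3 (F.cover 3) K) (siteEquiv (F.cover 3) K ct) z ≤ 12 * ((F.cover 3).L : ℝ) ^ (K - n) + 4 →
      tdist (periodsT3 F K) (siteEquiv F K (proj (F.P K) 3 0 ct)) (siteEquiv F K (proj (F.P K) 3 0 ((siteEquiv (F.cover 3) K).symm z)))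
        ≤ 12 * (F.L : ℝ) ^ (K - n) + 4 := by
    intro ct z hz
    have h1 := tdist_siteEquiv_proj_le F 3 K ct ((siteEquiv (F.cover 3) K).symm z)
    rw [Equiv.apply_symm_apply] at h1
    exact h1.trans hz
  -- THE WEIGHTED-SUP ABSORPTION OVER THE COVER's BONDS with the member-induced weight
  have habs := weighted_sup_absorption (ι := PBond ((F.cover 3).P K) 0)
    (fun bt => ‖WL2.equiv ℂ (fun _ : Bond 3 (periodsT3 (F.cover 3) K) => c₀) W₂ (DL2 (F.cover 3) n K c₀ Ut ut) (bondEquiv (F.cover 3) K bt)‖)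
    (fun bt => (Site.tdist (P := F.P K) (iterBlockOf (K - n) (proj (F.P K) 3 0 bt.src)) y : ℝ))
    (fun bt => M * Real.exp (-(κ * (Site.tdist (P := F.P K) (iterBlockOf (K - n) (proj (F.P K) 3 0 bt.src)) y : ℝ))))
    (fun bt bt' => (Site.tdist (P := (F.cover 3).P K) (iterBlockOf (K - n) bt.src) (iterBlockOf (K - n) bt'.src) : ℝ) ≤ 51)
    (Cg := 1) (a := exists_curved_localGradient.choose * ((48 * ε₀) * (6 * Real.sqrt 2 * Real.sqrt 10 + 6 * Real.sqrt 2)))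
    (M := M) (κ := κ) (D := 51) hκ zero_le_one (fun _ => norm_nonneg _)
    (fun bt bt' hb => by
      -- neighbours upstairs are `51`-close downstairs
      have hπ : (Site.tdist (P := F.P K) (iterBlockOf (K - n) (proj (F.P K) 3 0 bt.src)) (iterBlockOf (K - n) (proj (F.P K) 3 0 bt'.src)) : ℝ) ≤ 51 := by
        have := tdist_iterBlockOf_proj_le F K 3 (K - n) hlev bt.src bt'.src
        exact le_trans (by exact_mod_cast this) hb
      have ht : (Site.tdist (P := F.P K) (iterBlockOf (K - n) (proj (F.P K) 3 0 bt.src)) y : ℝ)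
          ≤ (Site.tdist (P := F.P K) (iterBlockOf (K - n) (proj (F.P K) 3 0 bt.src)) (iterBlockOf (K - n) (proj (F.P K) 3 0 bt'.src)) : ℝ)
            + (Site.tdist (P := F.P K) (iterBlockOf (K - n) (proj (F.P K) 3 0 bt'.src)) y : ℝ) := by
        exact_mod_cast B3Taylor310LocalRemainder.tdist_triangle (iterBlockOf (K - n) (proj (F.P K) 3 0 bt.src)) (iterBlockOf (K - n) (proj (F.P K) 3 0 bt'.src)) y
      linarith)
    (fun bt Gb hGb => by
      rw [one_mul]
      -- the two letters on the COVER ball of `b̃₋`, bounded DOWNSTAIRS with the slack `e^{51κ}`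
      set Ed : ℝ := Real.exp (-(κ * (Site.tdist (P := F.P K) (iterBlockOf (K - n) (proj (F.P K) 3 0 bt.src)) y : ℝ))) with hEd
      have hMuBall : ∀ z, tdist (periodsT3 (F.cover 3) K) (siteEquiv (F.cover 3) K bt.src) z ≤ 12 * ((F.cover 3).L : ℝ) ^ (K - n) + 4 →
          ‖WL2.equiv ℂ (fun _ : TSite 3 (periodsT3 (F.cover 3) K) => c₀) W₂ ut z‖ ≤ Au * Real.exp (51 * κ) * Ed := fun z hz => by
        rw [hut_apply]
        exact decay_on_ball F n K (f := fun t => ‖WL2.equiv ℂ (fun _ : TSite 3 (periodsT3 F K) => c₀) W₂ u t‖) hAu hκ y hu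
          (proj (F.P K) 3 0 bt.src) _ (hball bt.src z hz)
      have hMqBall : ∀ z, tdist (periodsT3 (F.cover 3) K) (siteEquiv (F.cover 3) K bt.src) z ≤ 12 * ((F.cover 3).L : ℝ) ^ (K - n) + 4 →
          ‖WL2.equiv ℂ (fun _ : TSite 3 (periodsT3 (F.cover 3) K) => c₀) W₂ qt z‖ ≤ Aq * Real.exp (51 * κ) * Ed := fun z hz => by
        rw [hqt_apply]
        exact decay_on_ball F n K (f := fun t => ‖WL2.equiv ℂ (fun _ : TSite 3 (periodsT3 F K) => c₀) W₂ q t‖) hAq hκ y hq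
          (proj (F.P K) 3 0 bt.src) _ (hball bt.src z hz)
      have h1 := perBond_gradient_le_of_ball (F.cover 3) n K hε₀ hε1 Ut hregt c₀ ut qt hteq bt (by positivity) (by positivity) hMuBall hMqBall hroomt Gb hGb
      refine h1.trans (le_of_eq ?_)
      rw [hM]
      ring)
    (fun _ => le_rfl)
    (by rw [one_mul, mul_comm κ 51]; exact hsmall)
  -- READ BACK DOWNSTAIRS at a lift `b̃` of `b`
  intro b
  obtain ⟨bt, hbt⟩ := projBond_surjective (F.P K) 3 0 b
  have hsrc : proj (F.P K) 3 0 bt.src = b.src := by rw [← hbt]; rfl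
  have hDl := DL2_cover' F 3 n K c₀ U₀ l
  rw [hul] at hDl
  have e : WL2.equiv ℂ (fun _ : Bond 3 (periodsT3 (F.cover 3) K) => c₀) W₂ (DL2 (F.cover 3) n K c₀ Ut ut) (bondEquiv (F.cover 3) K bt)
      = WL2.equiv ℂ (fun _ : Bond 3 (periodsT3 F K) => c₀) W₂ (DL2 F n K c₀ U₀ u) (bondEquiv F K b) := by
    rw [hUt, hut, hDl, toL2_apply, Equiv.symm_apply_apply, Function.comp_apply, hbt, toL2_symm_apply, LinearEquiv.symm_apply_apply]
  have := habs bt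
  rw [e, hsrc] at this
  calc _ ≤ 2 * 1 * M * Real.exp (-(κ * (Site.tdist (P := F.P K) (iterBlockOf (K - n) b.src) y : ℝ))) := this
    _ = _ := by ring

omit jc in
include hε₀ hε1 hreg in
/-- ★★ **THE DECAYED GRADIENT ROW AT EVERY MEMBER, ROUTE-MATRIX READING**: the same bound for `‖toL2⁻¹(D_{U₀}u) b‖` (operator norm ≤ Frobenius norm = the `W₂` reading at `e b`,
✓`norm_frobEquiv_le`) — px21 ✓`gradient_decay_of_decay'` with `hroom` deleted. [cite: Balaban1985BackgroundPropagators, Thm 3.1 (3.42)–(3.44) pp.397–398, (3.11) p.392] -/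
theorem gradient_decay_of_decay_allMembers' (u q : SiteL2K ℂ 3 (periodsT3 F K) c₀ W₂)
    (h : covLapSite F n K c₀ U₀ u + q = DstarL2 F n K c₀ U₀ 0) (y : Site (F.P K) (K - n)) {κ Au Aq : ℝ} (hκ : 0 ≤ κ) (hAu : 0 ≤ Au) (hAq : 0 ≤ Aq)
    (hu : ∀ x : Site (F.P K) 0, ‖WL2.equiv ℂ (fun _ : TSite 3 (periodsT3 F K) => c₀) W₂ u (siteEquiv F K x)‖
      ≤ Au * Real.exp (-(κ * (Site.tdist (P := F.P K) (iterBlockOf (K - n) x) y : ℝ))))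
    (hq : ∀ x : Site (F.P K) 0, ‖WL2.equiv ℂ (fun _ : TSite 3 (periodsT3 F K) => c₀) W₂ q (siteEquiv F K x)‖
      ≤ Aq * Real.exp (-(κ * (Site.tdist (P := F.P K) (iterBlockOf (K - n) x) y : ℝ))))
    (hsmall : exists_curved_localGradient.choose * ((48 * ε₀) * (6 * Real.sqrt 2 * Real.sqrt 10 + 6 * Real.sqrt 2)) * Real.exp (51 * κ) ≤ 1 / 2)
    (b : PBond (F.P K) 0) :
    ‖(toL2 F K c₀).symm (DL2 F n K c₀ U₀ u) b‖
      ≤ 2 * ((exists_curved_localGradient.choose *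
            ((Au * Real.exp (51 * κ)) * (2 + 2 * Real.sqrt 2 * (4 * ε₀ * (3 + 2457 * norm_bgOfCfg_axialT_sub_le.choose)) + (24 * Real.sqrt 10 + 48) * (48 * ε₀) ^ 2)
              + Aq * Real.exp (51 * κ))
          + 2 * Real.sqrt 2 * (48 * ε₀) * (Au * Real.exp (51 * κ))))
        * Real.exp (-(κ * (Site.tdist (P := F.P K) (iterBlockOf (K - n) b.src) y : ℝ))) := by
  rw [toL2_symm_apply]
  exact (norm_frobEquiv_le _).trans (gradient_decay_of_decay_allMembers F n K hε₀ hε1 U₀ hreg c₀ u q h y hκ hAu hAq hu hq hsmall b)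

end Summit.QuantumFields.YangMills.Theorems.Prop7PoissonGradientDecayAllMembers

end
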